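import Summits.AtomisticToContinuum.HydrodynamicLimit.Theorems.TwoClocksTransferEntropyClockKineticWall
import Summits.AtomisticToContinuum.HydrodynamicLimit.Theorems.TwoClocksTransferEntropyClockInitialTails
import Summits.AtomisticToContinuum.HydrodynamicLimit.Theorems.TwoClocksTransferEntropyClockTailToMoment
import HarnessLib

/-!
# Crux `TwoClocks.TransferEntropyClock` (stmt-AtomisticToContinuum-16625), line `tail-rate`: the clock from the THREE REGISTERED
# DYNAMICAL STUBS, and item 14415 from its propagation stub alone (support file, lead c6, skeleton v15)

Skeleton v15 of the line (`Cruxes/TransferEntropyClock/Lines/tail_rate.lean`) closes the crux modulo three sorries, each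
byte-identical with the single open registered stub of the sibling item that owns it: `KCWUSharpPlus` (crux 16659),
`LCTSharp` (crux 17691) and the tail-propagation stub of item 14415 `UGibbsSRBRigidity.GaussianTails`. This file lands that
composition as theorems (no `sorry`, hypotheses explicit), so that it is importable and can serve as the `--glue-by` of a split:

* `gaussianTails_of_tailPropagation` — item 14415 BY NAME from its propagation stub ALONE: the t = 0 sub-Gaussian speed tails
  (`TransferEntropyClockInitialTails.stub_initialTails`, p163416, all real `σ`) and the tail-to-moment conversion
  (`TransferEntropyClockTailToMoment.stub_tailToMoment`, p163538) are landed; the composition is the birth skeleton's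
  (`c := κ/2`, constant `C · K(κ/2, κ)`, `F := Φ_N(s)` measurable);
* `transferEntropyClock_of_threeStubs : KCWUSharpPlus → LCTSharp → (tail propagation) → TwoClocks.TransferEntropyClock` —
  the crux by name (3-child glue p145986, s-axis net p147087);
* `transferEntropyClock_of_wall_lct_propagation` — the same with the kinetic stub replaced by the one kinetic wall
  `KineticWindowLDBoundsUniform` of 9282/14443/16659 (`kcwuSharpPlus_of_boundsUniform`, p164091);
* `hydrodynamicLimit_of_threeStubs` — the sub-problem Statement from the three stubs and the crux's two true-law tail antecedents.

References: H.-T. Yau, Lett. Math. Phys. 22 (1991) §2; B. Nachtergaele, H.-T. Yau, Comm. Math. Phys. 243 (2003) §2.3.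
-/

noncomputable section

namespace Summit.AtomisticToContinuum.HydrodynamicLimit.Theorems.TransferEntropyClockThreeStubs

open MeasureTheory Set Filter
open scoped ENNReal BigOperators
open Literature.Analysis.FluidPDE Literature.MathematicalPhysics.KineticTheory
open Summit.AtomisticToContinuum.HydrodynamicLimit.Theses
open Summit.AtomisticToContinuum.HydrodynamicLimit.Theorems.KineticWindowGronwallPlusNode (KineticWindowLDBoundsUniform)
open Summit.AtomisticToContinuum.HydrodynamicLimit.Theorems.TransferEntropyClockTailRate (KCWUSharpPlus)
open Summit.AtomisticToContinuum.HydrodynamicLimit.Theorems.HydroLimitInBandOfHeart (LocalClampedTransferWindowLDFamily)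
open Summit.AtomisticToContinuum.HydrodynamicLimit.Theorems.LocalClampedTransferSketch (LCTSharp)

/-- **Item 14415 `UGibbsSRBRigidity.GaussianTails` from its propagation stub alone.** Take `(κ₀, C₀)` from the landed t = 0
tails, `σ₀` from the propagation hypothesis; for `σ < σ₀`, a classical solution, a flow family with the LLN at `0` and `t < T`
take `(κ, C, N₀)` from the propagation, set `c := κ/2` and the constant `C · K(κ/2, κ)` from the landed conversion applied to
`μ := λ^N`, `F := Φ_N(s)`. [cite: NachtergaeleYau2003, §2.3 Assumption II.1] -/
theorem gaussianTails_of_tailPropagation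
    (hProp : ∀ (a₀ θ₀ : Literature.MathematicalPhysics.KineticTheory.T3 → ℝ)
      (u₀ : Literature.MathematicalPhysics.KineticTheory.T3 → Literature.MathematicalPhysics.KineticTheory.V3),
      Continuous a₀ → Continuous θ₀ → Continuous u₀ → (∀ x, 0 < a₀ x) → (∀ x, 0 < θ₀ x) →
      ∀ κ₀ : ℝ, 0 < κ₀ → ∀ C₀ : ENNReal, C₀ < ⊤ →
      (∀ (σ : ℝ) (N : ℕ)
          (Φ : Literature.Analysis.FluidPDE.HardSphereFlow
            (Literature.Analysis.FluidPDE.Torus.geometry (Fin 3))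
            (Literature.MathematicalPhysics.KineticTheory.hsDiameter σ N) (N + 1))
          (k : ℕ),
          (∑ i : Fin (N + 1),
              Literature.MathematicalPhysics.KineticTheory.localGibbsLaw σ a₀ u₀ θ₀ N Φ
                {z | (k : ℝ) ≤ ‖(z i).2‖}) ≤
            ((N : ENNReal) + 1) * C₀ * ENNReal.ofReal (Real.exp (-(κ₀ * (k : ℝ) ^ 2)))) →
      ∃ σ₀ : ℝ, 0 < σ₀ ∧ ∀ σ : ℝ, 0 < σ → σ < σ₀ →
        ∀ (T : ℝ) (ρ θ : ℝ → Literature.MathematicalPhysics.KineticTheory.T3 → ℝ)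
          (u : ℝ → Literature.MathematicalPhysics.KineticTheory.T3 → Literature.MathematicalPhysics.KineticTheory.V3),
          Literature.MathematicalPhysics.KineticTheory.IsHardSphereEulerSolution σ T ρ u θ →
          ∀ Φ : (N : ℕ) → Literature.Analysis.FluidPDE.HardSphereFlow
              (Literature.Analysis.FluidPDE.Torus.geometry (Fin 3))
              (Literature.MathematicalPhysics.KineticTheory.hsDiameter σ N) (N + 1),
            Literature.MathematicalPhysics.KineticTheory.TendstoHydroFieldsAt
                (fun N => Literature.MathematicalPhysics.KineticTheory.localGibbsLaw σ a₀ u₀ θ₀ N (Φ N))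
                Φ ρ u θ 0 →
            ∀ t ∈ Set.Ico 0 T, ∃ κ : ℝ, 0 < κ ∧ ∃ C : ENNReal, C < ⊤ ∧ ∃ N₀ : ℕ, ∀ N : ℕ, N₀ ≤ N →
              ∀ s ∈ Set.Icc 0 t, ∀ k : ℕ,
                (∑ i : Fin (N + 1),
                    Literature.MathematicalPhysics.KineticTheory.localGibbsLaw σ a₀ u₀ θ₀ N (Φ N)
                      {z | (k : ℝ) ≤ ‖((Φ N).flow s z i).2‖}) ≤
                  ((N : ENNReal) + 1) * C * ENNReal.ofReal (Real.exp (-(κ * (k : ℝ) ^ 2)))) :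
    UGibbsSRBRigidity.GaussianTails := by
  intro a₀ θ₀ u₀ ha hθ hu ha0 hθ0
  obtain ⟨κ₀, hκ₀, C₀, hC₀, hT0⟩ := TransferEntropyClockInitialTails.stub_initialTails a₀ θ₀ u₀ ha hθ hu ha0 hθ0
  obtain ⟨σ₀, hσ₀, H⟩ := hProp a₀ θ₀ u₀ ha hθ hu ha0 hθ0 κ₀ hκ₀ C₀ hC₀ hT0
  refine ⟨σ₀, hσ₀, fun σ hσ hσ' T ρ θ u hsol Φ h0 t ht => ?_⟩
  obtain ⟨κ, hκ, C, hC, N₀, hN⟩ := H σ hσ hσ' T ρ θ u hsol Φ h0 t ht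
  obtain ⟨K, hK, hKbound⟩ := TransferEntropyClockTailToMoment.stub_tailToMoment κ (κ / 2) (by positivity) (by linarith)
  refine ⟨κ / 2, by positivity, C * K, ENNReal.mul_lt_top hC hK, N₀, fun N hNN s hs => ?_⟩
  exact hKbound N (Literature.MathematicalPhysics.KineticTheory.localGibbsLaw σ a₀ u₀ θ₀ N (Φ N))
    ((Φ N).flow s) ((Φ N).measurable_flow s) C (hN N hNN s hs)

/-- **The crux by name from the three registered dynamical stubs of skeleton v15** (the numeric kinetic rung = crux 16659's stub,
LCT♯ = crux 17691's stub through its landed s-axis net, tail propagation = item 14415's stub through `gaussianTails_of_tailPropagation`),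
via the landed 3-child glue of the line. [cite: Yau1991, §2] -/
theorem transferEntropyClock_of_threeStubs :
    TransferEntropyClockTailRate.KCWUSharpPlus → LocalClampedTransferSketch.LCTSharp → (∀ (a₀ θ₀ : Literature.MathematicalPhysics.KineticTheory.T3 → ℝ)
      (u₀ : Literature.MathematicalPhysics.KineticTheory.T3 → Literature.MathematicalPhysics.KineticTheory.V3),
      Continuous a₀ → Continuous θ₀ → Continuous u₀ → (∀ x, 0 < a₀ x) → (∀ x, 0 < θ₀ x) →
      ∀ κ₀ : ℝ, 0 < κ₀ → ∀ C₀ : ENNReal, C₀ < ⊤ →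
      (∀ (σ : ℝ) (N : ℕ)
          (Φ : Literature.Analysis.FluidPDE.HardSphereFlow
            (Literature.Analysis.FluidPDE.Torus.geometry (Fin 3))
            (Literature.MathematicalPhysics.KineticTheory.hsDiameter σ N) (N + 1))
          (k : ℕ),
          (∑ i : Fin (N + 1),
              Literature.MathematicalPhysics.KineticTheory.localGibbsLaw σ a₀ u₀ θ₀ N Φ
                {z | (k : ℝ) ≤ ‖(z i).2‖}) ≤
            ((N : ENNReal) + 1) * C₀ * ENNReal.ofReal (Real.exp (-(κ₀ * (k : ℝ) ^ 2)))) →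
      ∃ σ₀ : ℝ, 0 < σ₀ ∧ ∀ σ : ℝ, 0 < σ → σ < σ₀ →
        ∀ (T : ℝ) (ρ θ : ℝ → Literature.MathematicalPhysics.KineticTheory.T3 → ℝ)
          (u : ℝ → Literature.MathematicalPhysics.KineticTheory.T3 → Literature.MathematicalPhysics.KineticTheory.V3),
          Literature.MathematicalPhysics.KineticTheory.IsHardSphereEulerSolution σ T ρ u θ →
          ∀ Φ : (N : ℕ) → Literature.Analysis.FluidPDE.HardSphereFlow
              (Literature.Analysis.FluidPDE.Torus.geometry (Fin 3))
              (Literature.MathematicalPhysics.KineticTheory.hsDiameter σ N) (N + 1),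
            Literature.MathematicalPhysics.KineticTheory.TendstoHydroFieldsAt
                (fun N => Literature.MathematicalPhysics.KineticTheory.localGibbsLaw σ a₀ u₀ θ₀ N (Φ N))
                Φ ρ u θ 0 →
            ∀ t ∈ Set.Ico 0 T, ∃ κ : ℝ, 0 < κ ∧ ∃ C : ENNReal, C < ⊤ ∧ ∃ N₀ : ℕ, ∀ N : ℕ, N₀ ≤ N →
              ∀ s ∈ Set.Icc 0 t, ∀ k : ℕ,
                (∑ i : Fin (N + 1),
                    Literature.MathematicalPhysics.KineticTheory.localGibbsLaw σ a₀ u₀ θ₀ N (Φ N)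
                      {z | (k : ℝ) ≤ ‖((Φ N).flow s z i).2‖}) ≤
                  ((N : ENNReal) + 1) * C * ENNReal.ofReal (Real.exp (-(κ * (k : ℝ) ^ 2)))) → TwoClocks.TransferEntropyClock := by
  intro hK hS hP
  exact TransferEntropyClockTailRate.transferEntropyClock_of_tailRateChildren hK
    (show LocalClampedTransferWindowLDFamily from LocalClampedTransferSketch.stub_sAxisNet hS)
    (gaussianTails_of_tailPropagation hP)

/-- **The crux by name from the one kinetic wall, LCT♯ and tail propagation** (`kcwuSharpPlus_of_boundsUniform`, p164091).
[cite: Yau1991, §2] -/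
theorem transferEntropyClock_of_wall_lct_propagation
    (hU : KineticWindowLDBoundsUniform) (hS : LCTSharp)
    (hP : ∀ (a₀ θ₀ : Literature.MathematicalPhysics.KineticTheory.T3 → ℝ)
      (u₀ : Literature.MathematicalPhysics.KineticTheory.T3 → Literature.MathematicalPhysics.KineticTheory.V3),
      Continuous a₀ → Continuous θ₀ → Continuous u₀ → (∀ x, 0 < a₀ x) → (∀ x, 0 < θ₀ x) →
      ∀ κ₀ : ℝ, 0 < κ₀ → ∀ C₀ : ENNReal, C₀ < ⊤ →
      (∀ (σ : ℝ) (N : ℕ)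
          (Φ : Literature.Analysis.FluidPDE.HardSphereFlow
            (Literature.Analysis.FluidPDE.Torus.geometry (Fin 3))
            (Literature.MathematicalPhysics.KineticTheory.hsDiameter σ N) (N + 1))
          (k : ℕ),
          (∑ i : Fin (N + 1),
              Literature.MathematicalPhysics.KineticTheory.localGibbsLaw σ a₀ u₀ θ₀ N Φ
                {z | (k : ℝ) ≤ ‖(z i).2‖}) ≤
            ((N : ENNReal) + 1) * C₀ * ENNReal.ofReal (Real.exp (-(κ₀ * (k : ℝ) ^ 2)))) →
      ∃ σ₀ : ℝ, 0 < σ₀ ∧ ∀ σ : ℝ, 0 < σ → σ < σ₀ →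
        ∀ (T : ℝ) (ρ θ : ℝ → Literature.MathematicalPhysics.KineticTheory.T3 → ℝ)
          (u : ℝ → Literature.MathematicalPhysics.KineticTheory.T3 → Literature.MathematicalPhysics.KineticTheory.V3),
          Literature.MathematicalPhysics.KineticTheory.IsHardSphereEulerSolution σ T ρ u θ →
          ∀ Φ : (N : ℕ) → Literature.Analysis.FluidPDE.HardSphereFlow
              (Literature.Analysis.FluidPDE.Torus.geometry (Fin 3))
              (Literature.MathematicalPhysics.KineticTheory.hsDiameter σ N) (N + 1),
            Literature.MathematicalPhysics.KineticTheory.TendstoHydroFieldsAt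
                (fun N => Literature.MathematicalPhysics.KineticTheory.localGibbsLaw σ a₀ u₀ θ₀ N (Φ N))
                Φ ρ u θ 0 →
            ∀ t ∈ Set.Ico 0 T, ∃ κ : ℝ, 0 < κ ∧ ∃ C : ENNReal, C < ⊤ ∧ ∃ N₀ : ℕ, ∀ N : ℕ, N₀ ≤ N →
              ∀ s ∈ Set.Icc 0 t, ∀ k : ℕ,
                (∑ i : Fin (N + 1),
                    Literature.MathematicalPhysics.KineticTheory.localGibbsLaw σ a₀ u₀ θ₀ N (Φ N)
                      {z | (k : ℝ) ≤ ‖((Φ N).flow s z i).2‖}) ≤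
                  ((N : ENNReal) + 1) * C * ENNReal.ofReal (Real.exp (-(κ * (k : ℝ) ^ 2)))) :
    TwoClocks.TransferEntropyClock :=
  transferEntropyClock_of_threeStubs (TransferEntropyClockKineticWall.kcwuSharpPlus_of_boundsUniform hU) hS hP

/-- **The restated clock over the three registered stubs**: the sub-problem Statement from the three dynamical stubs and the crux's
two true-law tail antecedents. [cite: Yau1991, §2] -/
theorem hydrodynamicLimit_of_threeStubs
    (hK : KCWUSharpPlus) (hS : LCTSharp)
    (hP : ∀ (a₀ θ₀ : Literature.MathematicalPhysics.KineticTheory.T3 → ℝ)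
      (u₀ : Literature.MathematicalPhysics.KineticTheory.T3 → Literature.MathematicalPhysics.KineticTheory.V3),
      Continuous a₀ → Continuous θ₀ → Continuous u₀ → (∀ x, 0 < a₀ x) → (∀ x, 0 < θ₀ x) →
      ∀ κ₀ : ℝ, 0 < κ₀ → ∀ C₀ : ENNReal, C₀ < ⊤ →
      (∀ (σ : ℝ) (N : ℕ)
          (Φ : Literature.Analysis.FluidPDE.HardSphereFlow
            (Literature.Analysis.FluidPDE.Torus.geometry (Fin 3))
            (Literature.MathematicalPhysics.KineticTheory.hsDiameter σ N) (N + 1))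
          (k : ℕ),
          (∑ i : Fin (N + 1),
              Literature.MathematicalPhysics.KineticTheory.localGibbsLaw σ a₀ u₀ θ₀ N Φ
                {z | (k : ℝ) ≤ ‖(z i).2‖}) ≤
            ((N : ENNReal) + 1) * C₀ * ENNReal.ofReal (Real.exp (-(κ₀ * (k : ℝ) ^ 2)))) →
      ∃ σ₀ : ℝ, 0 < σ₀ ∧ ∀ σ : ℝ, 0 < σ → σ < σ₀ →
        ∀ (T : ℝ) (ρ θ : ℝ → Literature.MathematicalPhysics.KineticTheory.T3 → ℝ)
          (u : ℝ → Literature.MathematicalPhysics.KineticTheory.T3 → Literature.MathematicalPhysics.KineticTheory.V3),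
          Literature.MathematicalPhysics.KineticTheory.IsHardSphereEulerSolution σ T ρ u θ →
          ∀ Φ : (N : ℕ) → Literature.Analysis.FluidPDE.HardSphereFlow
              (Literature.Analysis.FluidPDE.Torus.geometry (Fin 3))
              (Literature.MathematicalPhysics.KineticTheory.hsDiameter σ N) (N + 1),
            Literature.MathematicalPhysics.KineticTheory.TendstoHydroFieldsAt
                (fun N => Literature.MathematicalPhysics.KineticTheory.localGibbsLaw σ a₀ u₀ θ₀ N (Φ N))
                Φ ρ u θ 0 →
            ∀ t ∈ Set.Ico 0 T, ∃ κ : ℝ, 0 < κ ∧ ∃ C : ENNReal, C < ⊤ ∧ ∃ N₀ : ℕ, ∀ N : ℕ, N₀ ≤ N →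
              ∀ s ∈ Set.Icc 0 t, ∀ k : ℕ,
                (∑ i : Fin (N + 1),
                    Literature.MathematicalPhysics.KineticTheory.localGibbsLaw σ a₀ u₀ θ₀ N (Φ N)
                      {z | (k : ℝ) ≤ ‖((Φ N).flow s z i).2‖}) ≤
                  ((N : ENNReal) + 1) * C * ENNReal.ofReal (Real.exp (-(κ * (k : ℝ) ^ 2))))
    (h₇ : TwoClocks.TransferActivityTails) (h₆ : TwoClocks.EnergyCurrentTails) : _root_.HydrodynamicLimit :=
  TransferEntropyClockTailRate.hydrodynamicLimit_of_tailRateChildren hK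
    (show LocalClampedTransferWindowLDFamily from LocalClampedTransferSketch.stub_sAxisNet hS)
    (gaussianTails_of_tailPropagation hP) h₇ h₆

end Summit.AtomisticToContinuum.HydrodynamicLimit.Theorems.TransferEntropyClockThreeStubs

end
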